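import Summits.QuantumFields.YangMills.Theorems.BalabanUVNodesN15AveragingStencil
import Summits.QuantumFields.YangMills.Theorems.BalabanUVNodesN15EffectiveActionMatrix
import Summits.QuantumFields.YangMills.Theorems.BalabanUVNodesN15DefectKernel
import Literature.MathematicalPhysics.QuantumFieldTheory.Balaban1983to89.T4Cov2156Rate
import Literature.MathematicalPhysics.QuantumFieldTheory.Balaban1983to89.B6UnitTorusCarrier
import HarnessLib

/-!
# Route «BalabanUVNodes» (K4 «SpineRates»), node N15 = NE2, -a lane, part 21: THE FOURTH-ENTRY FACTOR `F = (Δ−∂∂*)H_k` — its entries as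
# two-block averages of `Δ_k`'s, their UNIFORM DECAY (`kernelDecay166`) and their TWO-LATTICE RATE THROUGH KING'S PAIRING (`kernelRate166` + the
# stencil discrepancy `≤ 1∕n`), and the defect `𝔇(F′, F)` in binder (a)'s format (`hasMaj_idef_lapHk`)

Cell `pub-ymgap`, seat `pub-ymgap-dag-n15-a` (KNIT-BY-NAME, generation g4; HUMAN RULING D-0062; chair R424 venue; `bears_on: R4∕N15`).  Filed
`--supports stmt-QuantumFields-19351` (helper).  THEOREMS ONLY; imports BY NAME parts 18 (`DstarD_mul_HkOp_eq`, `HkOp_conjTranspose_DstarD_HkOp_eq_DelK`),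
19 (`re_DelK_eq_deltaPol`), 20 (`QvOp_re_eq_lineWeight`, `QvOp_im_eq_zero`, `lineCount_bpt`, `lineWeight`), part 1 (`hasMaj_ofBlocks_of_entry_le`,
`idef_id_pull_single_apply`), b05-g9 `B5Kernel166Decay.kernelDecay166`, t4-ne2∕b06 `T4Cov2156Rate.kernelRate166`, `B6UnitTorusCarrier.pdist_rep_rep`.
Nothing in the tree is modified; nothing printed is a hypothesis.

THE POINT.  Parts 18–20 give, for a fine bond `(x, κ)` with `x = n·y₀ + a` and a unit bond `(y, λ)`,
`Re((Δ−∂∂*)H_k)((x,κ),(y,λ)) = ((a_κ+1)∕n)·Δ((y₀,κ),(y,λ)) + ((n−1−a_κ)∕n)·Δ((y₀−e_κ,κ),(y,λ))` with `Δ = deltaPol M n` read in torus coordinates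
(`re_lapker_bpt`).  Hence (§2) the entries decay like `Δ_k`'s, `|Re F| ≤ c₀e^{δ₀}e^{−δ₀|B(x)−y|_T}` uniformly in `n` and the volume (`kernelDecay166`),
and (§3) through King's pairing `x = pr x′` (same `y₀`, `a′_κ = Râ_κ + r`) the difference of the two runs' entries is at most
`(2θ₀e^{δ₁} + 2c₀e^{δ₀})·n⁻¹·e^{−min(δ₀,δ₁)|B(x)−y|_T}` (`kernelRate166` for `Δ′ − Δ` on both blocks + weight discrepancies `≤ 1∕n` times `kernelDecay166`) —
EXACTLY the shape of part 8's `norm_HkOp_kingPair_sub_le` for `H_k` (rate `η`, decay in King's unit-torus block distance), so that (§4) the defect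
`𝔇(F′, F)` has a block majorant in binder (a)'s format (`hasMaj_idef_lapHk`, part 11 §5's pattern) and the fourth entry of the vector piece can be
assembled exactly as parts 12∕14 assembled the second (part 22).

CONTENTS.  §1 `re_lapker_eq_sum` (`Re F((x,κ),(y,λ)) = Σ_z θ_n(x,z;κ)·Δ((z,κ),(y,λ))`), `sum_lineWeight_mul` (the two-block form), `re_lapker_bpt`;
`weight_pair_sub_le₁∕₂` (`|(a′+1)∕(Rn) − (â+1)∕n|, |(Rn−1−a′)∕(Rn) − (n−1−â)∕n| ≤ 1∕n`).  §2∕§3 **`lapker_bounds`**: `∃ c_F, C_F, δ_F > 0` (dimension only)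
with, for every unit torus, every `n ≥ 1`, `R ≥ 1`: `|Re F_n((x,κ),(y,λ))| ≤ c_F·e^{−δ_F|B(x)−y|_T}` and `|Re F_{Rn}((x′,κ),(y,λ)) − Re F_n((pr x′,κ),(y,λ))| ≤
(C_F∕n)·e^{−δ_F|B(x′)−y|_T}`.  §4 `exists_reLapLin` (the entry binder is inhabited), **`hasMaj_idef_lapHk`**.

HONEST FRAMING ∕ LIMITS.  `U = 1` linear theory on finite tori; the Laplacian is the gauge-fixed `Δ − ∂∂*` (part 18); every estimate is a cited tree theorem
(`kernelDecay166`, `kernelRate166` — themselves kernel theorems of the b05∕t4-ne2 lineages, NOT printed statements of [B5]∕[B6]); constants existential,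
dimension-only; count-neutral (typed 28∕28 · discharged unchanged); NOT a discharge of N15; one finite T⁴ at fixed ε — NOT infinite volume, NOT OS on ℝ⁴,
NOT a mass gap, NOT Clay.
-/

noncomputable section

open scoped BigOperators ComplexConjugate
open Finset Matrix

namespace Summit.QuantumFields.YangMills.BalabanUVNodes.N15.VectorPiece

open Literature.MathematicalPhysics.QuantumFieldTheory.Balaban1983to89
open Literature.MathematicalPhysics.QuantumFieldTheory.Balaban1983to89.B11SectG (BlockNorm HasMaj)
open Literature.MathematicalPhysics.QuantumFieldTheory.Balaban1983to89.T4EtaRateDefect (idef)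
open Literature.MathematicalPhysics.QuantumFieldTheory.Balaban1983to89.T4EtaRateCoeffDefect (pull fibre)
open Literature.MathematicalPhysics.QuantumFieldTheory.Balaban1983to89.B5Prop11Plancherel (Tor fine unitVec)
open Literature.MathematicalPhysics.QuantumFieldTheory.Balaban1983to89.B5Block118 (bpt tstep QvOp)
open Literature.MathematicalPhysics.QuantumFieldTheory.Balaban1983to89.B5Blocks16 (bpt_bijective)
open Literature.MathematicalPhysics.QuantumFieldTheory.Balaban1983to89.B5Hk163Torus (HkOp)
open Literature.MathematicalPhysics.QuantumFieldTheory.Balaban1983to89.B5Hk163RDiv (DstarD)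
open Literature.MathematicalPhysics.QuantumFieldTheory.Balaban1983to89.B6Cov2156Torus (deltaPol one_le_M KernelDecay)
open Literature.MathematicalPhysics.QuantumFieldTheory.Balaban1983to89.B6LowerBound2153Torus (rep rep_mem_pbox)
open Literature.MathematicalPhysics.QuantumFieldTheory.Balaban1983to89.B6BondEliminationTorus (pdist)
open Literature.MathematicalPhysics.QuantumFieldTheory.Balaban1983to89.B6UnitTorusCarrier (pdist_rep_rep)
open Literature.MathematicalPhysics.QuantumFieldTheory.Balaban1983to89.T4Cov2156Rate (kernelRate166)
open Literature.MathematicalPhysics.QuantumFieldTheory.Balaban1983to89.B5Kernel166Decay (kernelDecay166)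
open Literature.MathematicalPhysics.QuantumFieldTheory.King1986.Torus (blockOf tdistT tdistT_sub_unitVec_le tdistT_symm tdistT_triangle tdistT_nonneg)
open Summit.QuantumFields.YangMills.BalabanUVNodes.N15.DefectKernel (kingBlockOf_bpt pr_bpt hasMaj_ofBlocks_of_entry_le idef_id_pull_single_apply)

variable {d : ℕ} (n : ℕ) [NeZero n] (M : Fin (d + 1) → ℕ) [hM : ∀ μ, NeZero (M μ)]

/-! ## §1 The entries of `F = (Δ−∂∂*)H_k` as two-block averages of `Δ_k`'s -/

/-- `Δ_k` read in torus coordinates: `Δ((z,κ),(y,λ)) := deltaPol M n ((rep z, κ), (rep y, λ))`. (An abbreviation inside statements; no new object.) -/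
theorem re_lapker_eq_sum (x : Tor (fine n M)) (κ : Fin (d + 1)) (y : Tor M) (lam : Fin (d + 1)) :
    ((DstarD n M * HkOp n M) (x, κ) (y, lam)).re
      = ∑ z : Tor M, lineWeight n M κ x z * deltaPol M n (⟨rep M z, rep_mem_pbox M z⟩, κ) (⟨rep M y, rep_mem_pbox M y⟩, lam) := by
  have hn1 : 1 ≤ n := Nat.one_le_iff_ne_zero.mpr (NeZero.ne n)
  rw [DstarD_mul_HkOp_eq, HkOp_conjTranspose_DstarD_HkOp_eq_DelK n M hn1 one_pos, Matrix.mul_smul, Matrix.smul_apply, Matrix.mul_apply,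
    smul_eq_mul, Fintype.sum_prod_type]
  -- real part of `n^{d+1}·Σ_{(z,ι)} conj(Q((z,ι),(x,κ)))·Δ_k((z,ι),(y,λ))`
  rw [Finset.mul_sum, Complex.re_sum]
  refine Finset.sum_congr rfl fun z _ => ?_
  rw [Finset.mul_sum, Complex.re_sum, Finset.sum_eq_single κ]
  · rw [Matrix.conjTranspose_apply, Complex.star_def, show ((n : ℂ) ^ (d + 1)) = (((n : ℝ) ^ (d + 1) : ℝ) : ℂ) by push_cast; ring,
      Complex.re_ofReal_mul, Complex.mul_re, Complex.conj_re, Complex.conj_im, QvOp_im_eq_zero, neg_zero, zero_mul, sub_zero,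
      re_DelK_eq_deltaPol M n hn1 one_pos, ← mul_assoc, mul_comm ((n : ℝ) ^ (d + 1)), QvOp_re_eq_lineWeight, if_pos rfl]
  · intro ι _ hι
    rw [Matrix.conjTranspose_apply, Complex.star_def, show ((n : ℂ) ^ (d + 1)) = (((n : ℝ) ^ (d + 1) : ℝ) : ℂ) by push_cast; ring,
      Complex.re_ofReal_mul, Complex.mul_re, Complex.conj_re, Complex.conj_im, QvOp_im_eq_zero, neg_zero, zero_mul, sub_zero,
      ← mul_assoc, mul_comm ((n : ℝ) ^ (d + 1)), QvOp_re_eq_lineWeight, if_neg (fun h => hι h.symm), zero_mul]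
  · intro h; exact absurd (Finset.mem_univ κ) h

/-- The two-block form of a line-weighted sum: `Σ_z θ_n(n·y₀ + a, z; κ)·g(z) = ((a_κ+1)∕n)·g(y₀) + ((n−1−a_κ)∕n)·g(y₀ − e_κ)`. [cite: Balaban1984PropagatorsI, (1.18) p.20] -/
theorem sum_lineWeight_mul (y₀ : Tor M) (a : Fin (d + 1) → Fin n) (κ : Fin (d + 1)) (g : Tor M → ℝ) :
    ∑ z : Tor M, lineWeight n M κ (bpt n M y₀ a) z * g z
      = (((a κ : ℕ) : ℝ) + 1) / n * g y₀ + (((n - 1 - (a κ : ℕ) : ℕ) : ℝ)) / n * g (y₀ - unitVec M κ) := by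
  classical
  unfold lineWeight
  simp_rw [lineCount_bpt n M y₀ _ a κ, Nat.cast_add, add_div, add_mul, Finset.sum_add_distrib]
  congr 1
  · rw [Finset.sum_eq_single y₀]
    · rw [if_pos rfl]; push_cast; ring
    · intro z _ hz; rw [if_neg hz, Nat.cast_zero, zero_div, zero_mul]
    · intro h; exact absurd (Finset.mem_univ _) h
  · rw [Finset.sum_eq_single (y₀ - unitVec M κ)]
    · rw [if_pos (sub_add_cancel _ _)]
    · intro z _ hz
      rw [if_neg (fun h => hz (by rw [← h, add_sub_cancel_right])), Nat.cast_zero, zero_div, zero_mul]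
    · intro h; exact absurd (Finset.mem_univ _) h

/-- **THE ENTRY OF `(Δ−∂∂*)H_k` IN BLOCK COORDINATES**: `Re F((n·y₀ + a, κ),(y,λ)) = ((a_κ+1)∕n)·Δ((y₀,κ),(y,λ)) + ((n−1−a_κ)∕n)·Δ((y₀−e_κ,κ),(y,λ))`.
[cite: Balaban1984PropagatorsI, (1.18) p.20, (1.65) p.29] -/
theorem re_lapker_bpt (y₀ : Tor M) (a : Fin (d + 1) → Fin n) (κ : Fin (d + 1)) (y : Tor M) (lam : Fin (d + 1)) :
    ((DstarD n M * HkOp n M) (bpt n M y₀ a, κ) (y, lam)).re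
      = (((a κ : ℕ) : ℝ) + 1) / n * deltaPol M n (⟨rep M y₀, rep_mem_pbox M y₀⟩, κ) (⟨rep M y, rep_mem_pbox M y⟩, lam)
        + (((n - 1 - (a κ : ℕ) : ℕ) : ℝ)) / n *
          deltaPol M n (⟨rep M (y₀ - unitVec M κ), rep_mem_pbox M (y₀ - unitVec M κ)⟩, κ) (⟨rep M y, rep_mem_pbox M y⟩, lam) := by
  rw [re_lapker_eq_sum, sum_lineWeight_mul]

/-- The two weights are in `[0,1]` and sum to `1`. [folklore] -/
theorem weights_nonneg_sum (a : Fin (d + 1) → Fin n) (κ : Fin (d + 1)) :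
    0 ≤ (((a κ : ℕ) : ℝ) + 1) / n ∧ 0 ≤ (((n - 1 - (a κ : ℕ) : ℕ) : ℝ)) / n ∧
      (((a κ : ℕ) : ℝ) + 1) / n + (((n - 1 - (a κ : ℕ) : ℕ) : ℝ)) / n = 1 := by
  have hn : (0 : ℝ) < n := by exact_mod_cast Nat.pos_of_ne_zero (NeZero.ne n)
  have ha : (a κ : ℕ) < n := (a κ).isLt
  refine ⟨by positivity, by positivity, ?_⟩
  rw [← add_div, div_eq_one_iff_eq hn.ne', Nat.cast_sub (by omega), Nat.cast_sub (by omega)]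
  push_cast; ring

omit hM in
/-- Weight discrepancy through King's pairing, first block: `|(a′+1)∕(Rn) − (â+1)∕n| ≤ 1∕n` (`a′ = Râ + r`, `0 ≤ r < R`). [folklore] -/
theorem weight_pair_sub_le₁ (R : ℕ) [NeZero R] {a' ah : ℕ} (hover : a' / R = ah) :
    |((a' : ℝ) + 1) / ((R * n : ℕ) : ℝ) - ((ah : ℝ) + 1) / n| ≤ 1 / n := by
  have hn : (0 : ℝ) < n := by exact_mod_cast Nat.pos_of_ne_zero (NeZero.ne n)
  have hR : (0 : ℝ) < R := by exact_mod_cast Nat.pos_of_ne_zero (NeZero.ne R)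
  have hRn : (0 : ℝ) < R * n := mul_pos hR hn
  have hdm := Nat.div_add_mod a' R
  rw [hover] at hdm
  have hr : a' % R < R := Nat.mod_lt _ (Nat.pos_of_ne_zero (NeZero.ne R))
  have hrR : (((a' % R : ℕ)) : ℝ) + 1 ≤ R := by exact_mod_cast hr
  have hr0 : (0 : ℝ) ≤ ((a' % R : ℕ) : ℝ) := Nat.cast_nonneg _
  have hcast : ((R * n : ℕ) : ℝ) = R * n := by push_cast; ring
  rw [hcast, show ((ah : ℝ) + 1) / (n : ℝ) = R * ((ah : ℝ) + 1) / (R * n) by field_simp, ← sub_div, abs_div, abs_of_pos hRn,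
    div_le_div_iff₀ hRn hn, ← hdm]
  push_cast
  have : |(R : ℝ) * ah + ((a' % R : ℕ) : ℝ) + 1 - R * ((ah : ℝ) + 1)| ≤ R := by
    rw [abs_le]; constructor <;> linarith
  nlinarith [this, abs_nonneg ((R : ℝ) * ah + ((a' % R : ℕ) : ℝ) + 1 - R * ((ah : ℝ) + 1))]

omit hM in
/-- Weight discrepancy through King's pairing, second block: `|(Rn−1−a′)∕(Rn) − (n−1−â)∕n| ≤ 1∕n`. [folklore] -/
theorem weight_pair_sub_le₂ (R : ℕ) [NeZero R] {a' ah : ℕ} (ha' : a' < R * n) (hah : ah < n) (hover : a' / R = ah) :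
    |(((R * n - 1 - a' : ℕ)) : ℝ) / ((R * n : ℕ) : ℝ) - (((n - 1 - ah : ℕ)) : ℝ) / n| ≤ 1 / n := by
  have hn : (0 : ℝ) < n := by exact_mod_cast Nat.pos_of_ne_zero (NeZero.ne n)
  have hR : (0 : ℝ) < R := by exact_mod_cast Nat.pos_of_ne_zero (NeZero.ne R)
  have hRn : (0 : ℝ) < R * n := mul_pos hR hn
  have hdm := Nat.div_add_mod a' R
  rw [hover] at hdm
  have hr : a' % R < R := Nat.mod_lt _ (Nat.pos_of_ne_zero (NeZero.ne R))
  have hrR : (((a' % R : ℕ)) : ℝ) + 1 ≤ R := by exact_mod_cast hr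
  have hr0 : (0 : ℝ) ≤ ((a' % R : ℕ) : ℝ) := Nat.cast_nonneg _
  have hcast : ((R * n : ℕ) : ℝ) = R * n := by push_cast; ring
  rw [hcast, Nat.cast_sub (by omega), Nat.cast_sub (by omega), Nat.cast_sub (by omega), Nat.cast_sub (by omega),
    show (((n : ℕ) : ℝ) - (1 : ℕ) - (ah : ℝ)) / (n : ℝ) = R * (((n : ℕ) : ℝ) - (1 : ℕ) - (ah : ℝ)) / (R * n) by field_simp, ← sub_div, abs_div,
    abs_of_pos hRn, div_le_div_iff₀ hRn hn, ← hdm]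
  push_cast
  have : |(R : ℝ) * n - 1 - (R * ah + ((a' % R : ℕ) : ℝ)) - R * ((n : ℝ) - 1 - ah)| ≤ R := by
    rw [abs_le]; constructor <;> linarith
  nlinarith [this, abs_nonneg ((R : ℝ) * n - 1 - (R * ah + ((a' % R : ℕ) : ℝ)) - R * ((n : ℝ) - 1 - ah))]


/-! ## §2–§3 Uniform decay and the two-lattice rate through King's pairing -/

/-- `e^{−δ|y₀ − e_κ − y|} ≤ e^{δ}·e^{−δ|y₀ − y|}` (the neighbouring block is one step away). [folklore] -/
theorem exp_neighbour_le {δ : ℝ} (hδ : 0 ≤ δ) (y₀ y : Tor M) (κ : Fin (d + 1)) :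
    Real.exp (-(δ * tdistT M (y₀ - unitVec M κ) y)) ≤ Real.exp δ * Real.exp (-(δ * tdistT M y₀ y)) := by
  rw [← Real.exp_add]
  apply Real.exp_le_exp.mpr
  have h1 : tdistT M y₀ y ≤ tdistT M y₀ (y₀ - unitVec M κ) + tdistT M (y₀ - unitVec M κ) y := tdistT_triangle M _ _ _
  have h2 : tdistT M y₀ (y₀ - unitVec M κ) ≤ 1 := tdistT_sub_unitVec_le M y₀ κ
  nlinarith

/-- `e^{−δ|y₀ − y|} ≤ e^{δ}·e^{−δ|y₀ − y|}` (`δ ≥ 0`). [folklore] -/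
theorem exp_le_exp_mul {δ : ℝ} (hδ : 0 ≤ δ) (t : ℝ) : Real.exp (-(δ * t)) ≤ Real.exp δ * Real.exp (-(δ * t)) :=
  le_mul_of_one_le_left (Real.exp_nonneg _) (Real.one_le_exp hδ)

/-- `e^{−δ₁t} ≤ e^{−min(δ₀,δ₁)t}` for `t ≥ 0`. [folklore] -/
theorem exp_min_le {δ₀ δ₁ t : ℝ} (ht : 0 ≤ t) : Real.exp (-(δ₁ * t)) ≤ Real.exp (-(min δ₀ δ₁ * t)) :=
  Real.exp_le_exp.mpr (neg_le_neg (mul_le_mul_of_nonneg_right (min_le_right _ _) ht))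

/-- `e^{−δ₀t} ≤ e^{−min(δ₀,δ₁)t}` for `t ≥ 0`. [folklore] -/
theorem exp_min_le' {δ₀ δ₁ t : ℝ} (ht : 0 ≤ t) : Real.exp (-(δ₀ * t)) ≤ Real.exp (-(min δ₀ δ₁ * t)) :=
  Real.exp_le_exp.mpr (neg_le_neg (mul_le_mul_of_nonneg_right (min_le_left _ _) ht))

/-- **THE KERNEL BOUNDS OF `F = (Δ−∂∂*)H_k`** (dimension-only constants): UNIFORM DECAY `|Re F_n((x,κ),(y,λ))| ≤ c_F·e^{−δ_F|B(x)−y|_T}` for every `n ≥ 1` and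
every volume (`kernelDecay166` on the two blocks), and the TWO-LATTICE RATE THROUGH KING'S PAIRING `|Re F_{Rn}((x′,κ),(y,λ)) − Re F_n((pr x′,κ),(y,λ))| ≤
(C_F∕n)·e^{−δ_F|B(x′)−y|_T}` (`kernelRate166` on the two blocks + the weight discrepancies `≤ 1∕n` times `kernelDecay166`).
[cite: Balaban1984PropagatorsI, (1.18) p.20, (1.65)–(1.66) p.29 (objects); King1986, Prop. 3.8 (3.71) p.664 (shape of the rate)] -/
theorem lapker_bounds : ∃ cF CF δF : ℝ, 0 < cF ∧ 0 < CF ∧ 0 < δF ∧ ∀ (M : Fin (d + 1) → ℕ) [∀ μ, NeZero (M μ)] (n : ℕ) [NeZero n],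
    (∀ (x : Tor (fine n M)) (κ : Fin (d + 1)) (y : Tor M) (lam : Fin (d + 1)),
      |((DstarD n M * HkOp n M) (x, κ) (y, lam)).re| ≤ cF * Real.exp (-(δF * tdistT M (blockOf n M x) y))) ∧
    (∀ (R : ℕ) [NeZero R] (pr : Tor (fine (R * n) M) → Tor (fine n M)) (_ : ∀ x' ν, (pr x' ν).val = (x' ν).val / R)
      (x' : Tor (fine (R * n) M)) (κ : Fin (d + 1)) (y : Tor M) (lam : Fin (d + 1)),
      |((DstarD (R * n) M * HkOp (R * n) M) (x', κ) (y, lam)).re - ((DstarD n M * HkOp n M) (pr x', κ) (y, lam)).re|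
        ≤ CF / n * Real.exp (-(δF * tdistT M (blockOf (R * n) M x') y))) := by
  obtain ⟨c₀, δ₀, hc₀, hδ₀, HD⟩ := kernelDecay166 (d := d + 1) (by omega)
  obtain ⟨θ₀, δ₁, hθ₀, hδ₁, HR⟩ := kernelRate166 (d := d + 1) (by omega)
  refine ⟨c₀ * Real.exp δ₀, 2 * θ₀ * Real.exp δ₁ + 2 * c₀ * Real.exp δ₀, min δ₀ δ₁, by positivity, by positivity, lt_min hδ₀ hδ₁, ?_⟩
  intro M _ n _
  have hn : (0 : ℝ) < n := by exact_mod_cast Nat.pos_of_ne_zero (NeZero.ne n)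
  have hn1 : 1 ≤ n := Nat.one_le_iff_ne_zero.mpr (NeZero.ne n)
  -- `Δ_k`'s entries in torus coordinates and their decay
  have hdec : ∀ (m : ℕ) [NeZero m] (z y : Tor M) (κ lam : Fin (d + 1)), 1 ≤ m →
      |deltaPol M m (⟨rep M z, rep_mem_pbox M z⟩, κ) (⟨rep M y, rep_mem_pbox M y⟩, lam)| ≤ c₀ * Real.exp (-(δ₀ * tdistT M z y)) := by
    intro m _ z y κ lam hm
    have h := HD M m hm (⟨rep M z, rep_mem_pbox M z⟩, κ) (⟨rep M y, rep_mem_pbox M y⟩, lam)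
    rwa [pdist_rep_rep M (one_le_M M) z y] at h
  have hrat : ∀ (R : ℕ) [NeZero R] (z y : Tor M) (κ lam : Fin (d + 1)),
      |deltaPol M (R * n) (⟨rep M z, rep_mem_pbox M z⟩, κ) (⟨rep M y, rep_mem_pbox M y⟩, lam)
          - deltaPol M n (⟨rep M z, rep_mem_pbox M z⟩, κ) (⟨rep M y, rep_mem_pbox M y⟩, lam)|
        ≤ θ₀ * (n : ℝ)⁻¹ * Real.exp (-(δ₁ * tdistT M z y)) := by
    intro R _ z y κ lam
    have h := HR M n (R * n) R hn1 (Nat.one_le_iff_ne_zero.mpr (NeZero.ne R)) rfl (⟨rep M z, rep_mem_pbox M z⟩, κ) (⟨rep M y, rep_mem_pbox M y⟩, lam)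
    rwa [pdist_rep_rep M (one_le_M M) z y] at h
  refine ⟨fun x κ y lam => ?_, fun R _ pr hpr x' κ y lam => ?_⟩
  · -- uniform decay
    obtain ⟨⟨y₀, a⟩, rfl⟩ := (bpt_bijective n M).2 x
    simp only [kingBlockOf_bpt]
    obtain ⟨hw₁, hw₂, hsum⟩ := weights_nonneg_sum n a κ
    rw [re_lapker_bpt]
    have hT : 0 ≤ tdistT M y₀ y := tdistT_nonneg M _ _
    have e1 : Real.exp (-(δ₀ * tdistT M y₀ y)) ≤ Real.exp δ₀ * Real.exp (-(min δ₀ δ₁ * tdistT M y₀ y)) :=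
      (exp_le_exp_mul hδ₀.le _).trans (mul_le_mul_of_nonneg_left (exp_min_le' hT) (Real.exp_nonneg _))
    have e2 : Real.exp (-(δ₀ * tdistT M (y₀ - unitVec M κ) y)) ≤ Real.exp δ₀ * Real.exp (-(min δ₀ δ₁ * tdistT M y₀ y)) :=
      (exp_neighbour_le M hδ₀.le y₀ y κ).trans (mul_le_mul_of_nonneg_left (exp_min_le' hT) (Real.exp_nonneg _))
    have b1 := hdec n y₀ y κ lam hn1
    have b2 := hdec n (y₀ - unitVec M κ) y κ lam hn1
    calc _ ≤ (((a κ : ℕ) : ℝ) + 1) / n * |deltaPol M n (⟨rep M y₀, rep_mem_pbox M y₀⟩, κ) (⟨rep M y, rep_mem_pbox M y⟩, lam)|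
          + (((n - 1 - (a κ : ℕ) : ℕ) : ℝ)) / n *
            |deltaPol M n (⟨rep M (y₀ - unitVec M κ), rep_mem_pbox M (y₀ - unitVec M κ)⟩, κ) (⟨rep M y, rep_mem_pbox M y⟩, lam)| := by
          refine (abs_add_le _ _).trans (le_of_eq ?_)
          rw [abs_mul, abs_mul, abs_of_nonneg hw₁, abs_of_nonneg hw₂]
      _ ≤ (((a κ : ℕ) : ℝ) + 1) / n * (c₀ * (Real.exp δ₀ * Real.exp (-(min δ₀ δ₁ * tdistT M y₀ y))))
          + (((n - 1 - (a κ : ℕ) : ℕ) : ℝ)) / n * (c₀ * (Real.exp δ₀ * Real.exp (-(min δ₀ δ₁ * tdistT M y₀ y)))) := by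
          gcongr
          · exact b1.trans (mul_le_mul_of_nonneg_left e1 hc₀.le)
          · exact b2.trans (mul_le_mul_of_nonneg_left e2 hc₀.le)
      _ = c₀ * Real.exp δ₀ * Real.exp (-(min δ₀ δ₁ * tdistT M y₀ y)) := by
          rw [← add_mul, hsum, one_mul, mul_assoc]
  · -- the two-lattice rate through King's pairing
    haveI : NeZero (R * n) := inferInstance
    obtain ⟨⟨y₀, a'⟩, rfl⟩ := (bpt_bijective (R * n) M).2 x'
    simp only
    have hR : 0 < R := Nat.pos_of_ne_zero (NeZero.ne R)
    set ah : Fin (d + 1) → Fin n := fun ν => ⟨(a' ν : ℕ) / R, Nat.div_lt_of_lt_mul (a' ν).isLt⟩ with hah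
    have hover : ∀ ν, (a' ν : ℕ) / R = (ah ν : ℕ) := fun ν => rfl
    rw [pr_bpt R n M pr hpr y₀ a' ah hover, kingBlockOf_bpt, re_lapker_bpt, re_lapker_bpt]
    obtain ⟨hw₁', hw₂', -⟩ := weights_nonneg_sum (R * n) a' κ
    have hT : 0 ≤ tdistT M y₀ y := tdistT_nonneg M _ _
    -- names for the four kernel values
    set D'₁ := deltaPol M (R * n) (⟨rep M y₀, rep_mem_pbox M y₀⟩, κ) (⟨rep M y, rep_mem_pbox M y⟩, lam) with hD'₁
    set D₁ := deltaPol M n (⟨rep M y₀, rep_mem_pbox M y₀⟩, κ) (⟨rep M y, rep_mem_pbox M y⟩, lam) with hD₁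
    set D'₂ := deltaPol M (R * n) (⟨rep M (y₀ - unitVec M κ), rep_mem_pbox M (y₀ - unitVec M κ)⟩, κ) (⟨rep M y, rep_mem_pbox M y⟩, lam) with hD'₂
    set D₂ := deltaPol M n (⟨rep M (y₀ - unitVec M κ), rep_mem_pbox M (y₀ - unitVec M κ)⟩, κ) (⟨rep M y, rep_mem_pbox M y⟩, lam) with hD₂
    set w₁' := (((a' κ : ℕ) : ℝ) + 1) / ((R * n : ℕ) : ℝ) with hw₁'def
    set w₂' := (((R * n - 1 - (a' κ : ℕ) : ℕ) : ℝ)) / ((R * n : ℕ) : ℝ) with hw₂'def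
    set w₁ := (((ah κ : ℕ) : ℝ) + 1) / n with hw₁def
    set w₂ := (((n - 1 - (ah κ : ℕ) : ℕ) : ℝ)) / n with hw₂def
    set E := Real.exp (-(min δ₀ δ₁ * tdistT M y₀ y)) with hE
    have hw₁'le : w₁' ≤ 1 := by
      have := (weights_nonneg_sum (R * n) a' κ).2.2; rw [← hw₁'def, ← hw₂'def] at this; linarith
    have hw₂'le : w₂' ≤ 1 := by
      have := (weights_nonneg_sum (R * n) a' κ).2.2; rw [← hw₁'def, ← hw₂'def] at this; linarith
    have dw₁ : |w₁' - w₁| ≤ 1 / n := weight_pair_sub_le₁ n R (hover κ)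
    have dw₂ : |w₂' - w₂| ≤ 1 / n := weight_pair_sub_le₂ n R (a' κ).isLt (ah κ).isLt (hover κ)
    -- the four pieces
    have p1 : |D'₁ - D₁| ≤ θ₀ * (n : ℝ)⁻¹ * (Real.exp δ₁ * E) :=
      (hrat R y₀ y κ lam).trans (mul_le_mul_of_nonneg_left ((exp_le_exp_mul hδ₁.le _).trans
        (mul_le_mul_of_nonneg_left (exp_min_le hT) (Real.exp_nonneg _))) (by positivity))
    have p2 : |D'₂ - D₂| ≤ θ₀ * (n : ℝ)⁻¹ * (Real.exp δ₁ * E) :=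
      (hrat R (y₀ - unitVec M κ) y κ lam).trans (mul_le_mul_of_nonneg_left ((exp_neighbour_le M hδ₁.le y₀ y κ).trans
        (mul_le_mul_of_nonneg_left (exp_min_le hT) (Real.exp_nonneg _))) (by positivity))
    have p3 : |D₁| ≤ c₀ * (Real.exp δ₀ * E) :=
      (hdec n y₀ y κ lam hn1).trans (mul_le_mul_of_nonneg_left ((exp_le_exp_mul hδ₀.le _).trans
        (mul_le_mul_of_nonneg_left (exp_min_le' hT) (Real.exp_nonneg _))) hc₀.le)
    have p4 : |D₂| ≤ c₀ * (Real.exp δ₀ * E) :=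
      (hdec n (y₀ - unitVec M κ) y κ lam hn1).trans (mul_le_mul_of_nonneg_left ((exp_neighbour_le M hδ₀.le y₀ y κ).trans
        (mul_le_mul_of_nonneg_left (exp_min_le' hT) (Real.exp_nonneg _))) hc₀.le)
    have hE0 : 0 ≤ E := Real.exp_nonneg _
    -- regroup and bound
    have eq : w₁' * D'₁ + w₂' * D'₂ - (w₁ * D₁ + w₂ * D₂)
        = w₁' * (D'₁ - D₁) + (w₁' - w₁) * D₁ + w₂' * (D'₂ - D₂) + (w₂' - w₂) * D₂ := by ring
    rw [eq]
    calc _ ≤ |w₁' * (D'₁ - D₁)| + |(w₁' - w₁) * D₁| + |w₂' * (D'₂ - D₂)| + |(w₂' - w₂) * D₂| := by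
          refine (abs_add_le _ _).trans (add_le_add ((abs_add_le _ _).trans (add_le_add ((abs_add_le _ _).trans le_rfl) le_rfl)) le_rfl)
      _ = w₁' * |D'₁ - D₁| + |w₁' - w₁| * |D₁| + w₂' * |D'₂ - D₂| + |w₂' - w₂| * |D₂| := by
          rw [abs_mul, abs_mul, abs_mul, abs_mul, abs_of_nonneg hw₁', abs_of_nonneg hw₂']
      _ ≤ 1 * (θ₀ * (n : ℝ)⁻¹ * (Real.exp δ₁ * E)) + 1 / n * (c₀ * (Real.exp δ₀ * E))
          + 1 * (θ₀ * (n : ℝ)⁻¹ * (Real.exp δ₁ * E)) + 1 / n * (c₀ * (Real.exp δ₀ * E)) :=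
          add_le_add (add_le_add (add_le_add (mul_le_mul hw₁'le p1 (abs_nonneg _) zero_le_one)
            (mul_le_mul dw₁ p3 (abs_nonneg _) (by positivity))) (mul_le_mul hw₂'le p2 (abs_nonneg _) zero_le_one))
            (mul_le_mul dw₂ p4 (abs_nonneg _) (by positivity))
      _ = (2 * θ₀ * Real.exp δ₁ + 2 * c₀ * Real.exp δ₀) / n * E := by
          rw [div_eq_mul_inv]
          ring

/-! ## §4 The defect `𝔇(F′, F)` in binder (a)'s format -/

/-- The entry binder for `F = (Δ−∂∂*)H_k` is inhabited (real parts of the typed matrix product). [folklore] -/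
theorem exists_reLapLin : ∃ F : (Tor M × Fin (d + 1) → ℝ) →ₗ[ℝ] (Tor (fine n M) × Fin (d + 1) → ℝ),
    ∀ b i, F (Pi.single b 1) i = ((DstarD n M * HkOp n M) i b).re :=
  ⟨Matrix.mulVecLin ((DstarD n M * HkOp n M).map Complex.reLm), fun b i => by
    simp [Matrix.mulVec, dotProduct, Pi.single_apply, Matrix.map_apply]⟩

/-- **THE DEFECT OF THE FOURTH-ENTRY FACTOR IN BINDER (a)'s FORMAT.**  For `F_n = (Δ−∂∂*)H_n` and `F_{Rn}` read off as real linear maps through their entries,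
King's pairing of fine bonds, ANY carrier `g` with site assignments `blk₁` of the unit bonds (at most `n₀` per cube) and `blk₂` of the fine bonds whose distance
is dominated by King's unit-torus block distance at rate `δ_F`, and the paired rate `(C_F∕n)e^{−δ_F|B(x′)−y|_T}` of §3: `𝔇(F_{Rn}, F_n)` through (id, pull prV)
has the block majorant `n₀·(C_F∕n)·e^{−δd(y,y′)}` (part 11 §5's pattern). [cite: King1986, Prop. 3.8 (3.71) p.664 (shape); Balaban1985BackgroundPropagators, (3.42) p.397 (fourth entry, the format's use)] -/
theorem hasMaj_idef_lapHk (R : ℕ) [NeZero R] {g : B6.Geometry} [DecidableEq g.Site] (blk₁ : Tor M × Fin (d + 1) → g.Site)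
    (blk₂ : Tor (fine (R * n) M) × Fin (d + 1) → g.Site) {n₀ : ℕ} (hn₀ : ∀ y', (fibre blk₁ y').card ≤ n₀)
    (pr : Tor (fine (R * n) M) → Tor (fine n M))
    (prV : Tor (fine (R * n) M) × Fin (d + 1) → Tor (fine n M) × Fin (d + 1)) (hprV : ∀ i, prV i = (pr i.1, i.2))
    (F : (Tor M × Fin (d + 1) → ℝ) →ₗ[ℝ] (Tor (fine n M) × Fin (d + 1) → ℝ))
    (hF : ∀ b i, F (Pi.single b 1) i = ((DstarD n M * HkOp n M) i b).re)
    (F' : (Tor M × Fin (d + 1) → ℝ) →ₗ[ℝ] (Tor (fine (R * n) M) × Fin (d + 1) → ℝ))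
    (hF' : ∀ b i, F' (Pi.single b 1) i = ((DstarD (R * n) M * HkOp (R * n) M) i b).re)
    {CF δF : ℝ} (hCF : 0 ≤ CF)
    (hrate : ∀ (x' : Tor (fine (R * n) M)) (κ : Fin (d + 1)) (y : Tor M) (lam : Fin (d + 1)),
      |((DstarD (R * n) M * HkOp (R * n) M) (x', κ) (y, lam)).re - ((DstarD n M * HkOp n M) (pr x', κ) (y, lam)).re|
        ≤ CF / n * Real.exp (-(δF * tdistT M (blockOf (R * n) M x') y)))
    {δ : ℝ} (hdom : ∀ (i : Tor (fine (R * n) M) × Fin (d + 1)) (b : Tor M × Fin (d + 1)),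
      δ * g.dist (blk₂ i) (blk₁ b) ≤ δF * tdistT M (blockOf (R * n) M i.1) b.1) :
    HasMaj (BlockNorm.ofBlocks g blk₁) (BlockNorm.ofBlocks g blk₂) (idef LinearMap.id (pull prV) F' F)
      (fun y y' => n₀ * (CF / n) * Real.exp (-(δ * g.dist y y'))) := by
  have hn : (0 : ℝ) < n := by exact_mod_cast Nat.pos_of_ne_zero (NeZero.ne n)
  have hC : 0 ≤ CF / n := div_nonneg hCF hn.le
  have key := hasMaj_ofBlocks_of_entry_le blk₁ blk₂ (T := idef LinearMap.id (pull prV) F' F)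
    (κ := fun y y' => CF / n * Real.exp (-(δ * g.dist y y'))) (fun _ _ => mul_nonneg hC (Real.exp_nonneg _)) hn₀
    fun i b => by
      rw [idef_id_pull_single_apply, hF', hF, hprV]
      refine (hrate i.1 i.2 b.1 b.2).trans ?_
      exact mul_le_mul_of_nonneg_left (Real.exp_le_exp.mpr (by linarith [hdom i b])) hC
  exact key.mono fun y y' => le_of_eq (by ring)

end Summit.QuantumFields.YangMills.BalabanUVNodes.N15.VectorPiece
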